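import Mathlib.Data.Real.Basic
import HarnessLib

/-!
# Bui–Hall sign conjecture, hub-kernel port — the closed form `Λ(u,v;x,y)` of the master inequality (shared definitions)

LINE 1 — LABEL: RH-FREE (a theorem about explicit polynomial integrals — the sign of the main-term coefficient
`HARDY(k,ℓ,m,n)` of the mixed fourth moments of the derivatives of Hardy's `Z`); LADDER-RH materiality NIL
(director-rh 2026-08-27); class RECORDS → PAPERS. Nothing here bears on the truth of RH.

PROVENANCE (byte level). Hub-kernel PORT of the box file `run/shared/lean/archive/2001-boxes/rh/summits/rh-w-lgap/free/y2/lean/BuiHallSign.lean` (sha256/16 `560d5e447cc8ed51`),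
itself GENERATED by `run/shared/lean/archive/2001-boxes/rh/summits/rh-w-lgap/free/y2/lean/gen/gen_bh.py` (sha256/16 `80cee6d9d1ddbd5e`; `--assemble` from cells.json sha256
`03ab224ad42ef36c…` + certs.jsonl sha256 `240e612880cce7bc…`, run rh-lgapy2-bh-2, and the hand-written parts `gen/part_*.lean`).
This module = the SHARED DEFINITIONS BLOCK (`Fp`, `intP`, `nuSumLe`, `nuDiffGe`, `nuRect`, `Nfun`, `Lam`), byte-identical in the four box files (checked there by `gen/check_shared.py`); the box's domain predicate `InD` and the three seam Props `MasterTT/TF/F` are NOT ported (`MasterIneq` in `Sign1` spells `D` out; the hub modules import the part theorems directly).  Port edits ONLY: namespace `Literature.NumberTheory.LFunctions.BuiHall` (+ a `Part…` sub-namespace for the generated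
decision-tree names), the shared definitions block replaced by `import Literature.NumberTheory.LFunctions.BuiHall.Defs`, module split to the hub's file-size cap,
docstrings/provenance tags added; statements and proof scripts are verbatim unless a docstring says otherwise.

WHAT IS HERE (box paper = the 2001-box write-up `work/paper-v3-d979a68f.tex`, Section 4.1; print comparator Bui–Hall,
Bull. LMS 55 (2023) [BuiHall2023]): `Lam u v x y` is the paper's `Λ(u,v;r,r')` (`x = r`, `y = r'`) in the CLOSED FORM of
eq. (LamN)–(prims): `Λ = −N(1−u) − N(1+u) − N(u−v) + N(u+v)`, `N(t) = ν{|p−q| ≤ t} − ν{p+q ≤ t}` (`ν = pq dp dq` on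
`[x,1]×[y,1]`), `ν{|p−q| ≤ t} = ν(R) − ν{p−q ≥ t} − ν{q−p ≥ t}`, with the one-dimensional `p`-integrals of eq. (prims) evaluated
(`Fp` = the antiderivative of `p ↦ p(c₀ + c₁p + c₂p²)`; an empty range of integration is encoded by `max`, so no case distinction
is needed and every branch of the evaluator corresponds to resolving one `min`/`max`). That this closed form IS the two-window
integral of eq. (Lcd) (Lemma QI + eq. (prims)) is PROVED in the Sign modules (`core_QI`, `mixture_holds`); that `Λ ≤ 0` on
`D = {0 ≤ v ≤ u ≤ 1, 0 ≤ x, y ≤ 1}` (Theorem master) is PROVED by the 249 certificates of the `Certs…`/`Master…` modules.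
Definitions only; no named facts.
-/

noncomputable section

namespace Literature.NumberTheory.LFunctions.BuiHall

/-- antiderivative of `p ↦ p * (c0 + c1 p + c2 p^2)` [folklore] -/
def Fp (c0 c1 c2 p : ℝ) : ℝ := c0 * p ^ 2 / 2 + c1 * p ^ 3 / 3 + c2 * p ^ 4 / 4

/-- `∫_a^b p (c0 + c1 p + c2 p²) dp`, an empty range (`b ≤ a`) meaning `0` [folklore] -/
def intP (c0 c1 c2 a b : ℝ) : ℝ := Fp c0 c1 c2 (max a b) - Fp c0 c1 c2 a

/-- `ν{p + q ≤ t}` on `[x,1] × [y,1]`, first formula of eq. (prims), the `p`-integral split at `p = t - 1` [folklore] -/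
def nuSumLe (t x y : ℝ) : ℝ :=
  intP ((1 - y * y) / 2) 0 0 x (min (min 1 (t - y)) (t - 1))
    + intP ((t * t - y * y) / 2) (-t) (1/2 : ℝ) (max x (t - 1)) (min 1 (t - y))

/-- `ν{p - q ≥ t}` on `[x,1] × [y,1]` (`t ≥ 0`), second formula of eq. (prims) [folklore] -/
def nuDiffGe (t x y : ℝ) : ℝ := intP ((t * t - y * y) / 2) (-t) (1/2 : ℝ) (max x (y + t)) 1

/-- `ν([x,1]×[y,1]) = (1-x²)(1-y²)/4` [folklore] -/
def nuRect (x y : ℝ) : ℝ := (1 - x * x) * (1 - y * y) / 4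

/-- `N(t) = ν{|p-q| ≤ t} - ν{p+q ≤ t}` for `t ≥ 0` (Lemma QI), with `ν{|p-q| ≤ t} = ν(R) - ν{p-q ≥ t} - ν{q-p ≥ t}` [folklore] -/
def Nfun (t x y : ℝ) : ℝ := nuRect x y - nuDiffGe t x y - nuDiffGe t y x - nuSumLe t x y

/-- the master function `Λ(u,v;x,y)` of eq. (LamN) [folklore] -/
def Lam (u v x y : ℝ) : ℝ :=
  - Nfun (1 - u) x y - Nfun (1 + u) x y - Nfun (u - v) x y + Nfun (u + v) x y

end Literature.NumberTheory.LFunctions.BuiHall
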